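import Summits.AtomisticToContinuum.HydrodynamicLimit.Theorems.LambertianContactSwapLambertianEulerIterate
import Summits.AtomisticToContinuum.HydrodynamicLimit.Theorems.LambertianContactSwapLambertianEulerWindow
import Summits.AtomisticToContinuum.HydrodynamicLimit.Theorems.LambertianContactSwapLambertianEulerMarkov
import HarnessLib

/-!
# A.e. forward regularity of the Lambertian hard-sphere flow
# (`LambertianContactSwap.LambertianEuler`, stmt-AtomisticToContinuum-11854, line `Sketch`;
# sub-goal `lambert_ae_fwdGood` of the stub `stub_tailsLambda`)

The Λ-analogue of Alexander's theorem (`Literature.Analysis.FluidPDE.HardSphereAlexander`: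
`fwdGoodUpTo_of_mem_iterGood`, `volume_not_fwdGoodUpTo_eq_zero`, `volume_not_fwdGood_eq_zero`) for
the Lambertian hard-sphere flow `Λ` on `𝕋³` driven by i.i.d. Gaussian redraws: for
`liouville ⊗ γ^ℕ`-a.e. pair (datum, noise), every finite exit configuration of the recursion is a
simple incoming collision, no pair touches strictly inside a free flight, and the collision instants
are unbounded.

Route. Truncated regularity up to a horizon (`lRegSet`, the three hypotheses of
`LRestart.lambert_fwdGoodUpTo_add`) holds over one short window from a short-time good datum of an
energy shell for every noise whose first Gaussian vector gives a non-degenerate Lambertian direction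
about every pair normal (`LWindow.lambert_window_free` / `LWindow.lambert_window_hit`), an event of
full `γ^ℕ`-measure (complement of `headBad`); it is additive under restart with the shifted noise. On the survivors
`iterGoodL k` of the GST iteration (`…LambertianEulerIterateGood`) the pairs not regular up to
`(k+1)δ` are `vol ⊗ γ^ℕ`-null, by induction: the restarted pair at time `kδ` must fall in `headBad`,
whose measure is computed by the fresh-tail transfer `lintegral_iterGoodL_succ_fresh` (MARKOV,
`…LambertianEulerMarkov.stub_markovLambda`). The loss `shell \ iterGoodL m` is `≤ (m+1)·windowLoss → 0`
(`…LambertianEulerIterate.measure_shell_diff_iterGoodL_le`, WINDOW `…LambertianEulerWindow.stub_windowLambda`),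
so non-regularity up to `t` is null on every shell; union over integer horizons and shells, and
`LRestart.lambert_fwdGood_of_forall` (`mem_lRegSet_forall`). [cite: GST2013, proof of Prop. 4.1.1 p. 19]
-/

noncomputable section

open scoped BigOperators Topology ENNReal InnerProductSpace
open MeasureTheory ProbabilityTheory Filter Set
open Literature.MathematicalPhysics.KineticTheory
open Literature.Analysis.FluidPDE Literature.Analysis.FluidPDE.Alexander
open Summit.AtomisticToContinuum.HydrodynamicLimit.Theorems.LambertianContactSwapLambertianEulerIterateGood
open Summit.AtomisticToContinuum.HydrodynamicLimit.Theorems.LambertianContactSwapLambertianEulerIterate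

namespace Summit.AtomisticToContinuum.HydrodynamicLimit.Theorems.LambertianContactSwapLambertianEulerFwdGood

/-! ## Truncated forward regularity of the Lambertian recursion -/

section RegUpTo

variable {d : Type*} [Fintype d] {X : Type*} {N : ℕ}

/-- **The pairs (datum, noise) whose Lambertian recursion is forward regular up to the horizon `T`**:
simple incoming exits at the instants `≤ T`, no touch strictly inside the free flights before `T`, and
some instant beyond `T` (the Lambertian copy of `Alexander.FwdGoodUpTo`; the three hypotheses of
`LRestart.lambert_fwdGoodUpTo_add`). [folklore] -/
def lRegSet (G : Geometry d X) (N : ℕ) (ε T : ℝ) : Set (Config N d X × (ℕ → EuclideanSpace ℝ d)) :=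
  {p | (∀ k, lambertInstant G ε p.2 p.1 (k + 1) ≤ ENNReal.ofReal T →
      IsSimpleIncoming G ε (freeFlight G (freeExitTime G ε (lambertStateAfter G ε p.2 p.1 k)).toReal
        (lambertStateAfter G ε p.2 p.1 k))) ∧
    (∀ k (t : ℝ), 0 < t → ENNReal.ofReal t < freeExitTime G ε (lambertStateAfter G ε p.2 p.1 k) →
      lambertInstant G ε p.2 p.1 k + ENNReal.ofReal t ≤ ENNReal.ofReal T →
      ∀ i j : Fin N, i ≠ j → freeFlight G t (lambertStateAfter G ε p.2 p.1 k) ∉ contactSet G N ε i j) ∧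
    (∃ k, ENNReal.ofReal T < lambertInstant G ε p.2 p.1 k)}

variable {G : Geometry d X} {ε : ℝ} {ξs : ℕ → EuclideanSpace ℝ d} {z : Config N d X}

/-- **Truncated regularity is additive under restart with the shifted noise**
(`LRestart.lambert_fwdGoodUpTo_add`). [folklore] -/
theorem mem_lRegSet_add {s u : ℝ} (hs : 0 ≤ s) (hu : 0 ≤ u) (hz : (z, ξs) ∈ lRegSet G N ε s)
    (hw : (lambertFlow G ε ξs z s, fun n => ξs (n + lambertCount G ε ξs z s)) ∈ lRegSet G N ε u) :
    (z, ξs) ∈ lRegSet G N ε (s + u) := by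
  obtain ⟨h1, h2, h3, -⟩ :=
    LRestart.lambert_fwdGoodUpTo_add (G := G) (ε := ε) (ξs := ξs) (z := z) hs hu hz.1 hz.2.1 hz.2.2
      hw.1 hw.2.1 hw.2.2
  exact ⟨h1, h2, h3⟩

/-- **Truncated regularity at every integer horizon gives the three untruncated clauses**: every
finite exit configuration is simple incoming, no touch strictly inside a free flight, and the instants
are unbounded (`LRestart.lambert_fwdGood_of_forall`). [folklore] -/
theorem mem_lRegSet_forall {p : Config N d X × (ℕ → EuclideanSpace ℝ d)}
    (h : ∀ T : ℕ, p ∈ lRegSet G N ε T) :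
    (∀ k, freeExitTime G ε (lambertStateAfter G ε p.2 p.1 k) ≠ ⊤ →
        IsSimpleIncoming G ε (freeFlight G (freeExitTime G ε (lambertStateAfter G ε p.2 p.1 k)).toReal
          (lambertStateAfter G ε p.2 p.1 k))) ∧
    (∀ k (t : ℝ), 0 < t → ENNReal.ofReal t < freeExitTime G ε (lambertStateAfter G ε p.2 p.1 k) →
        ∀ i j : Fin N, i ≠ j → freeFlight G t (lambertStateAfter G ε p.2 p.1 k) ∉ contactSet G N ε i j) ∧
    (∀ T : ℝ, ∃ k, ENNReal.ofReal T < lambertInstant G ε p.2 p.1 k) := by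
  obtain ⟨h1, h2, -⟩ := LRestart.lambert_fwdGood_of_forall (G := G) (ε := ε) (ξs := p.2) (z := p.1)
    fun T => h T
  refine ⟨h1, h2, fun T => ?_⟩
  obtain ⟨n, hn⟩ := exists_nat_ge T
  obtain ⟨k, hk⟩ := (h n).2.2
  exact ⟨k, (ENNReal.ofReal_le_ofReal hn).trans_lt hk⟩

end RegUpTo

/-! ## One window: regularity off the degenerate redraws -/

section Torus

open LWindow LambertianContactSwapLambertianEulerWindowPieces

variable {N : ℕ} {ε r δ V : ℝ}

variable (N ε) in
/-- The **degenerate redraws of one window**: pairs (datum, noise) whose first Gaussian vector gives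
a vanishing Lambertian direction about the would-be contact normal `hitPoint` of some couple of indices
`(i, j)` of the datum (all couples, the diagonal included: a finite union of `γ^ℕ`-null events in the
noise, `ae_lambertNoise_lambertDir_head_ne_zero`). [folklore] -/
def headBad : Set (Config N (Fin 3) T3 × (ℕ → V3)) :=
  {q | ∃ i j : Fin N, lambertDir (hitPoint ε ((Torus.geometry (Fin 3)).sepVec (q.1 i).1 (q.1 j).1,
      (q.1 i).2 - (q.1 j).2)) (q.2 0) = 0}

/-- The degenerate redraws form a measurable set. [folklore] -/
theorem measurableSet_headBad : MeasurableSet (headBad N ε) := by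
  refine measurableSet_setOf.2 (Measurable.exists fun i => Measurable.exists fun j => ?_)
  have hn : Measurable fun q : Config N (Fin 3) T3 × (ℕ → V3) =>
      hitPoint ε ((Torus.geometry (Fin 3)).sepVec (q.1 i).1 (q.1 j).1, (q.1 i).2 - (q.1 j).2) :=
    (HalfAngle.measurable_hitPoint ε).comp ((measurable_relData i j).comp measurable_fst)
  exact measurableSet_setOf.1 ((hn.lambertDir ((measurable_pi_apply 0).comp measurable_snd))
    (measurableSet_singleton (0 : V3)))

/-- Every noise-section of the degenerate redraws is `γ^ℕ`-null. [folklore] -/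
theorem ae_not_mem_headBad (w : Config N (Fin 3) T3) :
    ∀ᵐ ηs ∂(lambertNoise (Fin 3)), (w, ηs) ∉ headBad N ε := by
  have h : ∀ᵐ ηs ∂(lambertNoise (Fin 3)), ∀ i j : Fin N, lambertDir (hitPoint ε
      ((Torus.geometry (Fin 3)).sepVec (w i).1 (w j).1, (w i).2 - (w j).2)) (ηs 0) ≠ 0 :=
    ae_all_iff.2 fun i => ae_all_iff.2 fun j => ae_lambertNoise_lambertDir_head_ne_zero _
  exact h.mono fun ηs hη => fun ⟨i, j, hij⟩ => hη i j hij

/-- Every noise-section of the degenerate redraws is `γ^ℕ`-null, as a measure. [folklore] -/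
theorem measure_headBad_section (w : Config N (Fin 3) T3) :
    lambertNoise (Fin 3) (Prod.mk w ⁻¹' headBad N ε) = 0 := by
  have h := ae_not_mem_headBad (N := N) (ε := ε) w
  rw [ae_iff] at h
  refine measure_mono_null (fun ηs hη => ?_) h
  simpa only [mem_setOf_eq, not_not, mem_preimage] using hη

/-- Every noise-section of the degenerate redraws is `γ^ℕ`-null, in `lintegral` form. [folklore] -/
theorem lintegral_headBad_section (w : Config N (Fin 3) T3) :
    ∫⁻ ηs, (headBad N ε).indicator (1 : Config N (Fin 3) T3 × (ℕ → V3) → ℝ≥0∞) (w, ηs)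
      ∂(lambertNoise (Fin 3)) = 0 := by
  refine (lintegral_congr_ae ((ae_not_mem_headBad (ε := ε) w).mono fun ηs hη => ?_)).trans
    lintegral_zero
  exact Set.indicator_of_notMem hη _

/-- **Regularity over one window off the degenerate redraws**: from a short-time good datum of the
energy shell `E ≤ V²/2` (`4Vδ ≤ r`, `ε + 2r < 1/2`), the Lambertian recursion driven by a noise whose
first vector is non-degenerate about every pair normal is regular up to `δ`
(`LWindow.lambert_window_free` on the far set and the no-hit pieces, `LWindow.lambert_window_hit` on
the hit pieces). [folklore] -/
theorem mem_lRegSet_window (hε : 0 < ε) (hV0 : 0 ≤ V) (hδ : 0 ≤ δ) (hr4 : 4 * V * δ ≤ r)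
    (hεr : ε + 2 * r < 2⁻¹) {z : Config N (Fin 3) T3} (hz : z ∈ shortGood N ε r δ)
    (hE : configEnergy z ≤ V ^ 2 / 2) {ξs : ℕ → V3} (hξ : (z, ξs) ∉ headBad N ε) :
    (z, ξs) ∈ lRegSet (Torus.geometry (Fin 3)) N ε δ := by
  have hVδ : 0 ≤ 2 * V * δ := by positivity
  have hr2 : 2 * V * δ ≤ r := by linarith
  have hε' : ε < 2⁻¹ := by linarith
  have hV : ∀ k, ‖(z k).2‖ ≤ V := norm_vel_le_of_configEnergy_le hV0 hE
  have free : (∀ t ∈ Icc (0 : ℝ) δ, ∀ k l : Fin N, k ≠ l →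
      ε < ‖(Torus.geometry (Fin 3)).sepVec (freeFlight (Torus.geometry (Fin 3)) t z k).1
        (freeFlight (Torus.geometry (Fin 3)) t z l).1‖) →
      (z, ξs) ∈ lRegSet (Torus.geometry (Fin 3)) N ε δ := by
    intro H
    obtain ⟨h1, h2, h3, -, -⟩ := lambert_window_free hε' hδ H ξs
    exact ⟨h1, h2, h3⟩
  rcases mem_shortGood.1 hz with hfar | ⟨p, hp, hno | hhit⟩
  · exact free (forall_lt_norm_of_mem_farSet hV hr2 hfar)
  · exact free (forall_lt_norm_of_mem_noHitPiece hε hV hr2 hεr hno)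
  · have h : HitHyp ε r δ V z p.1 p.2 := HitHyp.mk hε hεr hr2 hV0 hE hp hhit
    have hξ' : lambertDir (hitPoint ε ((Torus.geometry (Fin 3)).sepVec (z p.1).1 (z p.2).1,
        (z p.1).2 - (z p.2).2)) (ξs 0) ≠ 0 := fun h0 => hξ ⟨p.1, p.2, h0⟩
    obtain ⟨h1, h2, h3, -, -⟩ := lambert_window_hit h hr4 hξ'
    exact ⟨h1, h2, h3⟩

/-! ## Regularity of the survivors up to the end of their windows -/

variable
  (hM : ∀ (z : Config N (Fin 3) T3) (s : ℝ), 0 ≤ s →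
    ∀ {m : ℕ} (r : Fin m → ℝ), (∀ i, 0 ≤ r i ∧ r i ≤ s) →
    ∀ {Q : Set (Fin m → Config N (Fin 3) T3)}, MeasurableSet Q →
    ∀ {H : Config N (Fin 3) T3 × (ℕ → V3) → ℝ≥0∞}, Measurable H →
      ∫⁻ ξs, {ξs : ℕ → V3 |
          (∃ k, ENNReal.ofReal s < lambertInstant (Torus.geometry (Fin 3)) ε ξs z k) ∧
          (fun i => lambertFlow (Torus.geometry (Fin 3)) ε ξs z (r i)) ∈ Q}.indicator
          (fun ξs => H (lambertFlow (Torus.geometry (Fin 3)) ε ξs z s,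
            fun n => ξs (n + lambertCount (Torus.geometry (Fin 3)) ε ξs z s))) ξs
          ∂(lambertNoise (Fin 3)) =
      ∫⁻ ξs, {ξs : ℕ → V3 |
          (∃ k, ENNReal.ofReal s < lambertInstant (Torus.geometry (Fin 3)) ε ξs z k) ∧
          (fun i => lambertFlow (Torus.geometry (Fin 3)) ε ξs z (r i)) ∈ Q}.indicator
          (fun ξs => ∫⁻ ηs, H (lambertFlow (Torus.geometry (Fin 3)) ε ξs z s, ηs)
            ∂(lambertNoise (Fin 3))) ξs
          ∂(lambertNoise (Fin 3)))

include hM in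
/-- **The survivors of `k` windows are regular up to `(k+1)δ`, almost surely** (Λ-analogue of
`Alexander.fwdGoodUpTo_of_mem_iterGood`; `4Vδ ≤ r`, `ε + 2r < 1/2`): by induction on `k`. For
`k = 0` the irregular pairs lie in the degenerate redraws `headBad`, null section by section. For
`k + 1`, a survivor regular up to `s = (k+1)δ` whose restarted pair `(Λ_s, ξs (· + K_s))` is off
`headBad` is regular up to `s + δ` (`Λ_s` is short-time good on the shell; one window; additivity
under restart), and by the fresh-tail transfer on the survivors (MARKOV) the measure of the survivors
restarting into `headBad` is the integral of the null sections of `headBad`.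
[cite: GST2013, proof of Prop. 4.1.1 p. 19] -/
theorem measure_iterGoodL_diff_lRegSet_eq_zero (hε : 0 < ε) (hV0 : 0 ≤ V) (hδ : 0 ≤ δ)
    (hr4 : 4 * V * δ ≤ r) (hεr : ε + 2 * r < 2⁻¹) :
    ∀ k : ℕ, (volume.prod (lambertNoise (Fin 3)))
      (iterGoodL N ε r δ V k \ lRegSet (Torus.geometry (Fin 3)) N ε (((k : ℝ) + 1) * δ)) = 0 := by
  have hVδ : 0 ≤ 2 * V * δ := by positivity
  have hε' : ε < 2⁻¹ := by linarith
  have hG := Torus.isHardSphereRegular_geometry (d := Fin 3) hε'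
  have hBad := measurableSet_headBad (N := N) (ε := ε)
  intro k
  induction k with
  | zero =>
    simp only [Nat.cast_zero, zero_add, one_mul]
    refine measure_mono_null ?_ (Measure.measure_prod_null_of_ae_null hBad
      (Eventually.of_forall fun w => ?_))
    · rintro ⟨z, ξs⟩ ⟨hg, hb⟩
      by_contra hnot
      exact hb (mem_lRegSet_window hε hV0 hδ hr4 hεr hg.1 hg.2.1 hnot)
    · show (lambertNoise (Fin 3)) (Prod.mk w ⁻¹' _) = 0
      exact measure_headBad_section w
  | succ k ih =>
    set s : ℝ := ((k : ℝ) + 1) * δ with hs_def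
    have hs : 0 ≤ s := by positivity
    have hcast : (((k + 1 : ℕ) : ℝ) + 1) * δ = s + δ := by rw [hs_def]; push_cast; ring
    rw [hcast]
    have hΛ := measurable_lambertFlow_torus (d := Fin 3) (N := N) hε' s
    have hRst : Measurable fun p : Config N (Fin 3) T3 × (ℕ → V3) =>
        (lambertFlow (Torus.geometry (Fin 3)) ε p.2 p.1 s,
          fun n => p.2 (n + lambertCount (Torus.geometry (Fin 3)) ε p.2 p.1 s)) :=
      hΛ.prodMk (measurable_shift (measurable_lambertCount hG Torus.isMeasurable_geometry s)
        measurable_snd)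
    have hGood := measurableSet_iterGoodL (N := N) (r := r) (δ := δ) (V := V) hε' (k + 1)
    -- an irregular survivor is irregular up to `s`, or restarts into the degenerate redraws
    have hsub : iterGoodL N ε r δ V (k + 1) \ lRegSet (Torus.geometry (Fin 3)) N ε (s + δ) ⊆
        (iterGoodL N ε r δ V k \ lRegSet (Torus.geometry (Fin 3)) N ε s) ∪
        (iterGoodL N ε r δ V (k + 1) ∩ {p |
          (lambertFlow (Torus.geometry (Fin 3)) ε p.2 p.1 s,
            fun n => p.2 (n + lambertCount (Torus.geometry (Fin 3)) ε p.2 p.1 s)) ∈ headBad N ε}) := by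
      rintro ⟨z, ξs⟩ ⟨hg, hb⟩
      by_cases hreg : (z, ξs) ∈ lRegSet (Torus.geometry (Fin 3)) N ε s
      · refine Or.inr ⟨hg, ?_⟩
        by_contra hnot
        apply hb
        have hw : lambertFlow (Torus.geometry (Fin 3)) ε ξs z s ∈ shortGood N ε r δ :=
          (hg.2.2 k (Nat.lt_succ_self k)).1
        have hEw : configEnergy (lambertFlow (Torus.geometry (Fin 3)) ε ξs z s) ≤ V ^ 2 / 2 :=
          (configEnergy_lambertFlow_le _ _ _).trans hg.2.1
        exact mem_lRegSet_add hs hδ hreg (mem_lRegSet_window hε hV0 hδ hr4 hεr hw hEw hnot)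
      · exact Or.inl ⟨iterGoodL_succ_subset k hg, hreg⟩
    refine measure_mono_null hsub (measure_union_null ih ?_)
    calc (volume.prod (lambertNoise (Fin 3))) (iterGoodL N ε r δ V (k + 1) ∩ {p |
          (lambertFlow (Torus.geometry (Fin 3)) ε p.2 p.1 s,
            fun n => p.2 (n + lambertCount (Torus.geometry (Fin 3)) ε p.2 p.1 s)) ∈ headBad N ε})
        = ∫⁻ p, (iterGoodL N ε r δ V (k + 1) ∩ {p |
          (lambertFlow (Torus.geometry (Fin 3)) ε p.2 p.1 s,
            fun n => p.2 (n + lambertCount (Torus.geometry (Fin 3)) ε p.2 p.1 s)) ∈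
              headBad N ε}).indicator 1 p ∂(volume.prod (lambertNoise (Fin 3))) :=
          (lintegral_indicator_one (hGood.inter (hRst hBad))).symm
      _ = ∫⁻ p, (iterGoodL N ε r δ V (k + 1)).indicator (fun p =>
          (headBad N ε).indicator (1 : Config N (Fin 3) T3 × (ℕ → V3) → ℝ≥0∞)
            (lambertFlow (Torus.geometry (Fin 3)) ε p.2 p.1 s,
              fun n => p.2 (n + lambertCount (Torus.geometry (Fin 3)) ε p.2 p.1 s))) p
            ∂(volume.prod (lambertNoise (Fin 3))) :=
          lintegral_congr fun p => indicator_inter_preimage_one _ _ _ p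
      _ = ∫⁻ p, (iterGoodL N ε r δ V (k + 1)).indicator (fun p =>
          ∫⁻ ηs, (headBad N ε).indicator (1 : Config N (Fin 3) T3 × (ℕ → V3) → ℝ≥0∞)
            (lambertFlow (Torus.geometry (Fin 3)) ε p.2 p.1 s, ηs) ∂(lambertNoise (Fin 3))) p
            ∂(volume.prod (lambertNoise (Fin 3))) :=
          lintegral_iterGoodL_succ_fresh hM hε' hδ k (measurable_one.indicator hBad)
      _ = 0 := by
          refine (lintegral_congr fun p => ?_).trans lintegral_zero
          by_cases hp : p ∈ iterGoodL N ε r δ V (k + 1)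
          · rw [Set.indicator_of_mem hp]
            exact lintegral_headBad_section _
          · exact Set.indicator_of_notMem hp _

/-! ## Regularity up to a fixed horizon on the energy shells -/

include hM in
/-- **On an energy shell, the pairs not regular up to a fixed horizon are null** (Λ-analogue of
`Alexander.volume_not_fwdGoodUpTo_eq_zero`): with `δ = t/(m+1)` and interaction length `4V₀δ`
(WINDOW `stub_windowLambda`, MARKOV), the irregular pairs of the shell `(D ∩ {E ≤ V₀²/2}) × (ℕ → V3)`
either do not survive `m` windows — measure `≤ (m+1)·windowLoss δ (2V₀) → 0`
(`measure_shell_diff_iterGoodL_le`, `Alexander.tendsto_windowLoss`) — or form a null set of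
survivors (`measure_iterGoodL_diff_lRegSet_eq_zero`). [cite: GST2013, proof of Prop. 4.1.1 p. 19] -/
theorem measure_shell_diff_lRegSet_eq_zero (hε : 0 < ε) (hε' : ε < 2⁻¹) {V₀ t : ℝ} (hV0 : 0 ≤ V₀)
    (ht : 0 ≤ t) :
    (volume.prod (lambertNoise (Fin 3)))
      ({z : Config N (Fin 3) T3 | z ∈ hardSphereDomain (Torus.geometry (Fin 3)) N ε ∧
        configEnergy z ≤ V₀ ^ 2 / 2} ×ˢ (univ : Set (ℕ → V3)) \ lRegSet (Torus.geometry (Fin 3)) N ε t) = 0 := by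
  have h2V0 : 0 ≤ 2 * V₀ := by positivity
  have hVV : V₀ ^ 2 / 2 ≤ (2 * V₀) ^ 2 / 2 := by nlinarith [sq_nonneg V₀]
  set S : Set (Config N (Fin 3) T3) :=
    {z | z ∈ hardSphereDomain (Torus.geometry (Fin 3)) N ε ∧ configEnergy z ≤ V₀ ^ 2 / 2}
  have key : ∀ m : ℕ, ε + 2 * (2 * (2 * V₀) * (t / ((m : ℝ) + 1))) < 2⁻¹ →
      (volume.prod (lambertNoise (Fin 3)))
          (S ×ˢ (univ : Set (ℕ → V3)) \ lRegSet (Torus.geometry (Fin 3)) N ε t) ≤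
        ((m : ℝ≥0∞) + 1) * windowLoss (d := Fin 3) N (t / ((m : ℝ) + 1)) (2 * V₀) := by
    intro m hch
    have hδ : 0 ≤ t / ((m : ℝ) + 1) := by positivity
    have hT : ((m : ℝ) + 1) * (t / ((m : ℝ) + 1)) = t := by field_simp
    have hr4 : 4 * V₀ * (t / ((m : ℝ) + 1)) ≤ 2 * (2 * V₀) * (t / ((m : ℝ) + 1)) := le_of_eq (by ring)
    obtain ⟨hW1, hW2⟩ :=
      LambertianContactSwapLambertianEulerWindow.stub_windowLambda hε (N := N) hV0 hδ hr4 hch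
    have hL : volume {z : Config N (Fin 3) T3 | z ∈ hardSphereDomain (Torus.geometry (Fin 3)) N ε ∧
        configEnergy z ≤ V₀ ^ 2 / 2 ∧ z ∉ shortGood N ε (2 * (2 * V₀) * (t / ((m : ℝ) + 1)))
          (t / ((m : ℝ) + 1))} ≤ windowLoss (d := Fin 3) N (t / ((m : ℝ) + 1)) (2 * V₀) := by
      refine le_trans (measure_mono fun z hz => ?_) (volume_shell_diff_shortGood_le hε hch h2V0 hδ)
      exact ⟨hz.1, hz.2.1.trans hVV, hz.2.2⟩
    have hB := measure_iterGoodL_diff_lRegSet_eq_zero hM hε hV0 hδ hr4 hch m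
    have hC := measure_shell_diff_iterGoodL_le hM hW1 hW2 hε' hδ hL m
    rw [hT] at hB
    calc (volume.prod (lambertNoise (Fin 3)))
          (S ×ˢ (univ : Set (ℕ → V3)) \ lRegSet (Torus.geometry (Fin 3)) N ε t)
        ≤ (volume.prod (lambertNoise (Fin 3)))
            ((iterGoodL N ε (2 * (2 * V₀) * (t / ((m : ℝ) + 1))) (t / ((m : ℝ) + 1)) V₀ m \
              lRegSet (Torus.geometry (Fin 3)) N ε t) ∪
            (S ×ˢ (univ : Set (ℕ → V3)) \
              iterGoodL N ε (2 * (2 * V₀) * (t / ((m : ℝ) + 1))) (t / ((m : ℝ) + 1)) V₀ m)) := by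
          refine measure_mono fun p hp => ?_
          by_cases hpm : p ∈ iterGoodL N ε (2 * (2 * V₀) * (t / ((m : ℝ) + 1))) (t / ((m : ℝ) + 1)) V₀ m
          · exact Or.inl ⟨hpm, hp.2⟩
          · exact Or.inr ⟨hp.1, hpm⟩
      _ ≤ 0 + ((m : ℝ≥0∞) + 1) * windowLoss (d := Fin 3) N (t / ((m : ℝ) + 1)) (2 * V₀) :=
          (measure_union_le _ _).trans (add_le_add hB.le hC)
      _ = _ := zero_add _
  refine le_antisymm (ge_of_tendsto (tendsto_windowLoss (d := Fin 3) (N := N) h2V0 ht) ?_) bot_le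
  filter_upwards [eventually_chart hε' (2 * V₀) t] with m hm
  exact key m hm

/-! ## The registered sub-goal -/

omit hM in
/-- **Registered sub-goal `lambert_ae_fwdGood` of `stub_tailsLambda`** (line `Sketch` of the crux
`LambertianContactSwap.LambertianEuler`): **a.e. forward regularity of the Lambertian hard-sphere
flow** on `𝕋³`, `0 < ε < 1/2` — for `liouville ⊗ γ^ℕ`-almost every pair (datum, noise), (1) every
finite exit configuration of the recursion is a simple incoming collision, (2) no pair is in contact
strictly inside a free flight, (3) the collision instants are unbounded. The irregular pairs of the
domain lie in the union over integer horizons `T` and integer speed bounds `V` of the null sets of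
`measure_shell_diff_lRegSet_eq_zero` (MARKOV fed by `stub_markovLambda`, WINDOW by
`stub_windowLambda`), and truncated regularity at every integer horizon gives the three clauses
(`mem_lRegSet_forall`). [cite: GST2013, proof of Prop. 4.1.1 p. 19] -/
theorem lambert_ae_fwdGood :
    ∀ {ε : ℝ}, 0 < ε → ε < 2⁻¹ → ∀ {N : ℕ},
      ∀ᵐ p ∂((liouville (Torus.geometry (Fin 3)) N ε).prod (lambertNoise (Fin 3))),
        (∀ k, freeExitTime (Torus.geometry (Fin 3)) ε
            (lambertStateAfter (Torus.geometry (Fin 3)) ε p.2 p.1 k) ≠ ⊤ →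
          IsSimpleIncoming (Torus.geometry (Fin 3)) ε
            (freeFlight (Torus.geometry (Fin 3))
              (freeExitTime (Torus.geometry (Fin 3)) ε
                (lambertStateAfter (Torus.geometry (Fin 3)) ε p.2 p.1 k)).toReal
              (lambertStateAfter (Torus.geometry (Fin 3)) ε p.2 p.1 k))) ∧
        (∀ k (s : ℝ), 0 < s →
          ENNReal.ofReal s < freeExitTime (Torus.geometry (Fin 3)) ε
            (lambertStateAfter (Torus.geometry (Fin 3)) ε p.2 p.1 k) →
          ∀ i j : Fin N, i ≠ j →
            freeFlight (Torus.geometry (Fin 3)) s (lambertStateAfter (Torus.geometry (Fin 3)) ε p.2 p.1 k) ∉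
              contactSet (Torus.geometry (Fin 3)) N ε i j) ∧
        (∀ T : ℝ, ∃ k, ENNReal.ofReal T < lambertInstant (Torus.geometry (Fin 3)) ε p.2 p.1 k) := by
  intro ε hε hε' N
  haveI := sigmaFinite_volume_config N
  have hD : MeasurableSet (hardSphereDomain (Torus.geometry (Fin 3)) N ε) :=
    measurableSet_hardSphereDomain _ Torus.measurable_geometry_sepVec N ε
  have hshell : ∀ V T : ℕ, (volume.prod (lambertNoise (Fin 3)))
      ({z : Config N (Fin 3) T3 | z ∈ hardSphereDomain (Torus.geometry (Fin 3)) N ε ∧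
        configEnergy z ≤ (V : ℝ) ^ 2 / 2} ×ˢ (univ : Set (ℕ → V3)) \
          lRegSet (Torus.geometry (Fin 3)) N ε (T : ℝ)) = 0 :=
    fun V T => measure_shell_diff_lRegSet_eq_zero
      (LambertianContactSwapLambertianEulerMarkov.stub_markovLambda hε hε') hε hε'
      (Nat.cast_nonneg V) (Nat.cast_nonneg T)
  have hae : ∀ᵐ p ∂(volume.prod (lambertNoise (Fin 3))),
      p ∈ hardSphereDomain (Torus.geometry (Fin 3)) N ε ×ˢ (univ : Set (ℕ → V3)) →
        ∀ T : ℕ, p ∈ lRegSet (Torus.geometry (Fin 3)) N ε (T : ℝ) := by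
    rw [ae_iff]
    refine measure_mono_null ?_ (measure_iUnion_null fun T : ℕ =>
      measure_iUnion_null fun V : ℕ => hshell V T)
    intro p hp
    rw [mem_setOf_eq, Classical.not_imp, not_forall] at hp
    obtain ⟨hpD, T, hT⟩ := hp
    obtain ⟨V, hV⟩ := exists_nat_configEnergy_le p.1
    exact mem_iUnion.2 ⟨T, mem_iUnion.2 ⟨V, ⟨⟨hpD.1, hV⟩, mem_univ _⟩, hT⟩⟩
  rw [liouville_eq, Measure.restrict_prod_eq_prod_univ,
    ae_restrict_iff' (hD.prod MeasurableSet.univ)]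
  filter_upwards [hae] with p hp hpD
  exact mem_lRegSet_forall (hp hpD)

end Torus

end Summit.AtomisticToContinuum.HydrodynamicLimit.Theorems.LambertianContactSwapLambertianEulerFwdGood

end
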